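import Summits.CriticalPhenomena.CardyFormulaZ2.Theorems.CardyComplexConeParafermionToSLESixFamiliesDiamondDefs
import Mathlib.Analysis.Complex.ReImTopology
import HarnessLib

/-!
# Line `potential-darboux-picard-diamond`, stub S4′ (`stub_identifyPotentialPh`): elementary geometry of the tilted rectangle

Helper file of the stub `stub_identifyPotentialPh` of crux `ParafermionToSLESixFamilies` (stmt-CriticalPhenomena-11389).
A marked diamond (`IsMarkedDiamond D`) has carrier the TILTED OPEN RECTANGLE
`{z | |re((z − c)e)| < α ∧ |im((z − c)e)| < β}`, `e = exp(−iπ/4)`, `α, β > 0`. Steps (i)–(iii) of the identification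
(density of the cells of an admissible discretisation in the closed diamond, side cells along a boundary segment, the
boundary trace) need its elementary geometry, which this file records for a general unimodular `e` (so that the four
sides are one statement up to `e ↦ e·i`): the tilted coordinates are `1`-Lipschitz and affine along segments
(`abs_re_tilt_sub_le`, `tilt_lineMap`); the open and the closed tilted rectangles are convex (`convex_tiltedBox`,
`convex_tiltedClosedBox`); closure, frontier, compactness (`closure_tiltedBox`, `mem_frontier_tiltedBox_iff`,
`isCompact_tiltedClosedBox`); every point of the closed rectangle is close to a shrunken closed rectangle
(`exists_mem_shrunk_tiltedBox`); and the two facts about boundary segments consumed by the trace argument: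
a non-degenerate segment contained in the frontier lies in ONE side line (`exists_sideLine_of_segment_subset_frontier`,
registered helper of the crux item: five points of the segment pigeonhole into the four side lines, and an affine
function with two zeros vanishes), and `e = exp(−iπ/4) = (1 − i)/√2` (`exp_neg_pi_div_four_mul_I`).
-/

noncomputable section

namespace Summit.CriticalPhenomena.CardyFormulaZ2.Cruxes.ParafermionToSLESixFamilies.PotentialDarbouxPicardDiamond

open scoped Topology ComplexConjugate
open Filter Set Metric Complex

/-! ## The rotation `e = exp(−iπ/4)` -/

/-- `exp(−iπ/4) = (1 − i)/√2`. -/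
theorem exp_neg_pi_div_four_mul_I : exp (-(Real.pi / 4 : ℝ) * I) = ((Real.sqrt 2 / 2 : ℝ) : ℂ) * (1 - I) := by
  have h : (-(Real.pi / 4 : ℝ) : ℂ) * I = ((-(Real.pi / 4) : ℝ) : ℂ) * I := by push_cast; ring
  rw [h, exp_mul_I, ← ofReal_cos, ← ofReal_sin, Real.cos_neg, Real.sin_neg, Real.cos_pi_div_four,
    Real.sin_pi_div_four]
  push_cast; ring

/-- `exp(−iπ/4)` is unimodular. -/
theorem norm_exp_neg_pi_div_four_mul_I : ‖exp (-(Real.pi / 4 : ℝ) * I)‖ = 1 := by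
  have h : (-(Real.pi / 4 : ℝ) : ℂ) * I = ((-(Real.pi / 4) : ℝ) : ℂ) * I := by push_cast; ring
  rw [h, norm_exp_ofReal_mul_I]

/-- The tilted coordinates of `exp(−iπ/4)`: `re((z−c)e) = (re + im)/√2`, `im((z−c)e) = (im − re)/√2` of `z − c`. -/
theorem re_im_mul_exp_neg_pi_div_four (w : ℂ) :
    (w * exp (-(Real.pi / 4 : ℝ) * I)).re = Real.sqrt 2 / 2 * (w.re + w.im) ∧
      (w * exp (-(Real.pi / 4 : ℝ) * I)).im = Real.sqrt 2 / 2 * (w.im - w.re) := by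
  rw [exp_neg_pi_div_four_mul_I]
  constructor
  · simp [mul_re]; ring
  · simp [mul_im]; ring

/-! ## Tilted coordinates -/

/-- The tilted coordinate is affine along a segment. -/
theorem tilt_lineMap (c e p q : ℂ) (t : ℝ) :
    (p + (t : ℂ) * (q - p) - c) * e = (p - c) * e + (t : ℂ) * ((q - p) * e) := by ring

/-- Convex combinations pass through the tilted coordinate. -/
theorem tilt_convex_comb {a b : ℝ} (hab : a + b = 1) (x y c e : ℂ) :
    (a • x + b • y - c) * e = (a : ℂ) * ((x - c) * e) + (b : ℂ) * ((y - c) * e) := by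
  have hab' : (a : ℂ) + (b : ℂ) = 1 := by exact_mod_cast hab
  rw [real_smul, real_smul]
  linear_combination (c * e) * hab'

/-- For unimodular `e` the tilted real coordinate is `1`-Lipschitz. -/
theorem abs_re_tilt_sub_le (c e : ℂ) (he : ‖e‖ = 1) (z w : ℂ) :
    |((z - c) * e).re - ((w - c) * e).re| ≤ ‖z - w‖ := by
  have h : ((z - c) * e).re - ((w - c) * e).re = ((z - w) * e).re := by
    rw [← sub_re]; congr 1; ring
  rw [h]
  calc |((z - w) * e).re| ≤ ‖(z - w) * e‖ := abs_re_le_norm _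
    _ = ‖z - w‖ := by rw [norm_mul, he, mul_one]

/-- For unimodular `e` the tilted imaginary coordinate is `1`-Lipschitz. -/
theorem abs_im_tilt_sub_le (c e : ℂ) (he : ‖e‖ = 1) (z w : ℂ) :
    |((z - c) * e).im - ((w - c) * e).im| ≤ ‖z - w‖ := by
  have h : ((z - c) * e).im - ((w - c) * e).im = ((z - w) * e).im := by
    rw [← sub_im]; congr 1; ring
  rw [h]
  calc |((z - w) * e).im| ≤ ‖(z - w) * e‖ := abs_im_le_norm _
    _ = ‖z - w‖ := by rw [norm_mul, he, mul_one]

/-- For unimodular `e`, `‖z − c‖ ≤ |re((z−c)e)| + |im((z−c)e)|`. -/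
theorem norm_sub_le_abs_re_add_abs_im_tilt (c e : ℂ) (he : ‖e‖ = 1) (z : ℂ) :
    ‖z - c‖ ≤ |((z - c) * e).re| + |((z - c) * e).im| := by
  calc ‖z - c‖ = ‖(z - c) * e‖ := by rw [norm_mul, he, mul_one]
    _ ≤ |((z - c) * e).re| + |((z - c) * e).im| := norm_le_abs_re_add_abs_im _

/-! ## Convexity -/

/-- The open tilted rectangle is convex. -/
theorem convex_tiltedBox (c e : ℂ) (α β : ℝ) :
    Convex ℝ {z : ℂ | |((z - c) * e).re| < α ∧ |((z - c) * e).im| < β} := by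
  intro x hx y hy a b ha hb hab
  simp only [mem_setOf_eq] at hx hy ⊢
  rw [tilt_convex_comb hab, add_re, add_im, re_ofReal_mul, re_ofReal_mul, im_ofReal_mul, im_ofReal_mul]
  rcases ha.eq_or_lt with rfl | ha'
  · simp only [zero_add] at hab
    subst hab
    simpa using hy
  constructor
  · calc |a * ((x - c) * e).re + b * ((y - c) * e).re| ≤ |a * ((x - c) * e).re| + |b * ((y - c) * e).re| :=
          abs_add_le _ _
      _ = a * |((x - c) * e).re| + b * |((y - c) * e).re| := by
          rw [abs_mul, abs_mul, abs_of_nonneg ha, abs_of_nonneg hb]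
      _ < a * α + b * α := add_lt_add_of_lt_of_le (mul_lt_mul_of_pos_left hx.1 ha')
          (mul_le_mul_of_nonneg_left hy.1.le hb)
      _ = α := by rw [← add_mul, hab, one_mul]
  · calc |a * ((x - c) * e).im + b * ((y - c) * e).im| ≤ |a * ((x - c) * e).im| + |b * ((y - c) * e).im| :=
          abs_add_le _ _
      _ = a * |((x - c) * e).im| + b * |((y - c) * e).im| := by
          rw [abs_mul, abs_mul, abs_of_nonneg ha, abs_of_nonneg hb]
      _ < a * β + b * β := add_lt_add_of_lt_of_le (mul_lt_mul_of_pos_left hx.2 ha')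
          (mul_le_mul_of_nonneg_left hy.2.le hb)
      _ = β := by rw [← add_mul, hab, one_mul]

/-- The closed tilted rectangle is convex. -/
theorem convex_tiltedClosedBox (c e : ℂ) (α β : ℝ) :
    Convex ℝ {z : ℂ | |((z - c) * e).re| ≤ α ∧ |((z - c) * e).im| ≤ β} := by
  intro x hx y hy a b ha hb hab
  simp only [mem_setOf_eq] at hx hy ⊢
  rw [tilt_convex_comb hab, add_re, add_im, re_ofReal_mul, re_ofReal_mul, im_ofReal_mul, im_ofReal_mul]
  constructor
  · calc |a * ((x - c) * e).re + b * ((y - c) * e).re| ≤ |a * ((x - c) * e).re| + |b * ((y - c) * e).re| :=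
          abs_add_le _ _
      _ = a * |((x - c) * e).re| + b * |((y - c) * e).re| := by
          rw [abs_mul, abs_mul, abs_of_nonneg ha, abs_of_nonneg hb]
      _ ≤ a * α + b * α := add_le_add (mul_le_mul_of_nonneg_left hx.1 ha) (mul_le_mul_of_nonneg_left hy.1 hb)
      _ = α := by rw [← add_mul, hab, one_mul]
  · calc |a * ((x - c) * e).im + b * ((y - c) * e).im| ≤ |a * ((x - c) * e).im| + |b * ((y - c) * e).im| :=
          abs_add_le _ _
      _ = a * |((x - c) * e).im| + b * |((y - c) * e).im| := by
          rw [abs_mul, abs_mul, abs_of_nonneg ha, abs_of_nonneg hb]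
      _ ≤ a * β + b * β := add_le_add (mul_le_mul_of_nonneg_left hx.2 ha) (mul_le_mul_of_nonneg_left hy.2 hb)
      _ = β := by rw [← add_mul, hab, one_mul]

/-! ## Closure, frontier, compactness -/

/-- The tilted rectangle as the preimage of an axis-parallel box under the homeomorphism `z ↦ (z − c)e`. -/
theorem tiltedBox_eq_preimage (c e : ℂ) (he : e ≠ 0) (α β : ℝ) :
    {z : ℂ | |((z - c) * e).re| < α ∧ |((z - c) * e).im| < β} =
      ((Homeomorph.subRight c).trans (Homeomorph.mulRight₀ e he)) ⁻¹' (Ioo (-α) α ×ℂ Ioo (-β) β) := by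
  ext z
  simp only [mem_setOf_eq, mem_preimage, Homeomorph.trans_apply, Homeomorph.subRight_apply,
    Homeomorph.coe_mulRight₀, mem_reProdIm, mem_Ioo, abs_lt]

/-- The closure of the open tilted rectangle (`α, β > 0`) is the closed one. -/
theorem closure_tiltedBox (c e : ℂ) (he : e ≠ 0) {α β : ℝ} (hα : 0 < α) (hβ : 0 < β) :
    closure {z : ℂ | |((z - c) * e).re| < α ∧ |((z - c) * e).im| < β} =
      {z : ℂ | |((z - c) * e).re| ≤ α ∧ |((z - c) * e).im| ≤ β} := by
  rw [tiltedBox_eq_preimage c e he, ← Homeomorph.preimage_closure, closure_reProdIm, closure_Ioo (by linarith),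
    closure_Ioo (by linarith)]
  ext z
  simp only [mem_setOf_eq, mem_preimage, Homeomorph.trans_apply, Homeomorph.subRight_apply,
    Homeomorph.coe_mulRight₀, mem_reProdIm, mem_Icc, abs_le]

/-- The frontier of the open tilted rectangle (`α, β > 0`): the points of the closed rectangle on one of the four side
lines. -/
theorem mem_frontier_tiltedBox_iff (c e : ℂ) (he : e ≠ 0) {α β : ℝ} (hα : 0 < α) (hβ : 0 < β) (z : ℂ) :
    z ∈ frontier {z : ℂ | |((z - c) * e).re| < α ∧ |((z - c) * e).im| < β} ↔
      (|((z - c) * e).re| ≤ α ∧ |((z - c) * e).im| ≤ β) ∧ (|((z - c) * e).re| = α ∨ |((z - c) * e).im| = β) := by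
  rw [tiltedBox_eq_preimage c e he, ← Homeomorph.preimage_frontier, frontier_reProdIm, closure_Ioo (by linarith),
    closure_Ioo (by linarith), frontier_Ioo (by linarith), frontier_Ioo (by linarith)]
  simp only [mem_preimage, Homeomorph.trans_apply, Homeomorph.subRight_apply, Homeomorph.coe_mulRight₀, mem_union,
    mem_reProdIm, mem_Icc, mem_insert_iff, mem_singleton_iff]
  set X := ((z - c) * e).re
  set Y := ((z - c) * e).im
  constructor
  · rintro (⟨hX, hY | hY⟩ | ⟨hX | hX, hY⟩)
    · exact ⟨⟨abs_le.2 hX, by rw [hY, abs_neg, abs_of_pos hβ]⟩, Or.inr (by rw [hY, abs_neg, abs_of_pos hβ])⟩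
    · exact ⟨⟨abs_le.2 hX, by rw [hY, abs_of_pos hβ]⟩, Or.inr (by rw [hY, abs_of_pos hβ])⟩
    · exact ⟨⟨by rw [hX, abs_neg, abs_of_pos hα], abs_le.2 hY⟩, Or.inl (by rw [hX, abs_neg, abs_of_pos hα])⟩
    · exact ⟨⟨by rw [hX, abs_of_pos hα], abs_le.2 hY⟩, Or.inl (by rw [hX, abs_of_pos hα])⟩
  · rintro ⟨⟨hX, hY⟩, h | h⟩
    · right
      refine ⟨?_, abs_le.1 hY⟩
      rcases le_or_gt 0 X with h0 | h0
      · right; rwa [abs_of_nonneg h0] at h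
      · left; rw [abs_of_neg h0] at h; linarith
    · left
      refine ⟨abs_le.1 hX, ?_⟩
      rcases le_or_gt 0 Y with h0 | h0
      · right; rwa [abs_of_nonneg h0] at h
      · left; rw [abs_of_neg h0] at h; linarith

/-- The open tilted rectangle is open. -/
theorem isOpen_tiltedBox (c e : ℂ) (α β : ℝ) :
    IsOpen {z : ℂ | |((z - c) * e).re| < α ∧ |((z - c) * e).im| < β} := by
  have hc : Continuous fun z : ℂ => (z - c) * e := by fun_prop
  exact (isOpen_lt (continuous_abs.comp (continuous_re.comp hc)) continuous_const).inter
    (isOpen_lt (continuous_abs.comp (continuous_im.comp hc)) continuous_const)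

/-- The closed tilted rectangle (unimodular `e`) is compact. -/
theorem isCompact_tiltedClosedBox (c e : ℂ) (he : ‖e‖ = 1) (α β : ℝ) :
    IsCompact {z : ℂ | |((z - c) * e).re| ≤ α ∧ |((z - c) * e).im| ≤ β} := by
  have hc : Continuous fun z : ℂ => (z - c) * e := by fun_prop
  refine Metric.isCompact_of_isClosed_isBounded ?_ ?_
  · exact (isClosed_le (continuous_abs.comp (continuous_re.comp hc)) continuous_const).inter
      (isClosed_le (continuous_abs.comp (continuous_im.comp hc)) continuous_const)
  · refine (isBounded_closedBall (x := c) (r := α + β)).subset fun z hz => ?_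
    rw [mem_closedBall, dist_eq_norm]
    exact (norm_sub_le_abs_re_add_abs_im_tilt c e he z).trans (add_le_add hz.1 hz.2)

/-! ## Shrinking towards the centre -/

/-- **Every point of the closed tilted rectangle is close to a shrunken closed rectangle.** For `0 < ρ ≤ min α β`, the
point `c + (1 − ρ/min α β)(z − c)` lies in the closed rectangle shrunk by `ρ` and within `ρ (α + β)/min α β` of `z`. -/
theorem exists_mem_shrunk_tiltedBox (c e : ℂ) (he : ‖e‖ = 1) {α β ρ : ℝ} (hα : 0 < α) (hβ : 0 < β) (hρ : 0 < ρ)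
    (hρle : ρ ≤ min α β) {z : ℂ} (hz : |((z - c) * e).re| ≤ α ∧ |((z - c) * e).im| ≤ β) :
    ∃ z' : ℂ, (|((z' - c) * e).re| ≤ α - ρ ∧ |((z' - c) * e).im| ≤ β - ρ) ∧
      dist z z' ≤ ρ * (α + β) / min α β := by
  set m := min α β with hm
  have hm0 : 0 < m := lt_min hα hβ
  set t : ℝ := ρ / m with ht
  have ht0 : 0 ≤ t := div_nonneg hρ.le hm0.le
  have ht1 : t ≤ 1 := (div_le_one hm0).2 hρle
  refine ⟨c + ((1 - t : ℝ) : ℂ) * (z - c), ?_, ?_⟩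
  · have hkey : (c + ((1 - t : ℝ) : ℂ) * (z - c) - c) * e = ((1 - t : ℝ) : ℂ) * ((z - c) * e) := by ring
    rw [hkey, re_ofReal_mul, im_ofReal_mul, abs_mul, abs_mul, abs_of_nonneg (by linarith)]
    have htα : ρ ≤ t * α := by
      rw [ht, div_mul_eq_mul_div, le_div_iff₀ hm0]
      exact mul_le_mul_of_nonneg_left (min_le_left α β) hρ.le
    have htβ : ρ ≤ t * β := by
      rw [ht, div_mul_eq_mul_div, le_div_iff₀ hm0]
      exact mul_le_mul_of_nonneg_left (min_le_right α β) hρ.le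
    constructor
    · calc (1 - t) * |((z - c) * e).re| ≤ (1 - t) * α := mul_le_mul_of_nonneg_left hz.1 (by linarith)
        _ ≤ α - ρ := by nlinarith
    · calc (1 - t) * |((z - c) * e).im| ≤ (1 - t) * β := mul_le_mul_of_nonneg_left hz.2 (by linarith)
        _ ≤ β - ρ := by nlinarith
  · have hd : dist z (c + ((1 - t : ℝ) : ℂ) * (z - c)) = t * ‖z - c‖ := by
      rw [dist_eq_norm]
      have : z - (c + ((1 - t : ℝ) : ℂ) * (z - c)) = (t : ℂ) * (z - c) := by push_cast; ring
      rw [this, norm_mul, norm_real, Real.norm_eq_abs, abs_of_nonneg ht0]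
    rw [hd]
    have hzc : ‖z - c‖ ≤ α + β := (norm_sub_le_abs_re_add_abs_im_tilt c e he z).trans (add_le_add hz.1 hz.2)
    calc t * ‖z - c‖ ≤ t * (α + β) := mul_le_mul_of_nonneg_left hzc ht0
      _ = ρ * (α + β) / min α β := by rw [ht, hm]; ring

/-! ## A segment in the frontier lies in one side line -/

/-- An affine function of a real variable with two distinct zeros vanishes identically. -/
theorem affine_eq_zero_of_two_zeros {a b t₁ t₂ : ℝ} (hne : t₁ ≠ t₂) (h₁ : a + t₁ * b = 0) (h₂ : a + t₂ * b = 0)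
    (t : ℝ) : a + t * b = 0 := by
  have hb : b = 0 := by
    have : (t₁ - t₂) * b = 0 := by linarith
    exact (mul_eq_zero.1 this).resolve_left (sub_ne_zero.2 hne)
  subst hb
  linarith

/-- **A non-degenerate segment contained in the frontier of the tilted rectangle lies in one of the four side lines**:
one of the tilted coordinates is constant, equal to `±α` resp. `±β`, along the whole segment. -/
theorem exists_sideLine_of_segment_subset_frontier : ∀ (c e : ℂ) (α β : ℝ) (p q : ℂ), e ≠ 0 → 0 < α → 0 < β → p ≠ q → segment ℝ p q ⊆ frontier {z : ℂ | |((z - c) * e).re| < α ∧ |((z - c) * e).im| < β} → (∀ z ∈ segment ℝ p q, ((z - c) * e).re = α) ∨ (∀ z ∈ segment ℝ p q, ((z - c) * e).re = -α) ∨ (∀ z ∈ segment ℝ p q, ((z - c) * e).im = β) ∨ (∀ z ∈ segment ℝ p q, ((z - c) * e).im = -β) := by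
  intro c e α β p q he hα hβ _hpq hsub
  -- the four affine functions `g k + t * g' k`, vanishing iff the point of parameter `t` is on side line `k`
  set X0 : ℝ := ((p - c) * e).re with hX0
  set X1 : ℝ := ((q - p) * e).re with hX1
  set Y0 : ℝ := ((p - c) * e).im with hY0
  set Y1 : ℝ := ((q - p) * e).im with hY1
  set g : Fin 4 → ℝ := ![X0 - α, X0 + α, Y0 - β, Y0 + β] with hg
  set g' : Fin 4 → ℝ := ![X1, X1, Y1, Y1] with hg'
  have hγ : ∀ t : ℝ, ((p + (t : ℂ) * (q - p) - c) * e).re = X0 + t * X1 ∧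
      ((p + (t : ℂ) * (q - p) - c) * e).im = Y0 + t * Y1 := fun t => by
    rw [tilt_lineMap, add_re, add_im, re_ofReal_mul, im_ofReal_mul]
    exact ⟨rfl, rfl⟩
  have hmemseg : ∀ t ∈ Icc (0:ℝ) 1, p + (t : ℂ) * (q - p) ∈ segment ℝ p q := fun t ht =>
    ⟨1 - t, t, by linarith [ht.2], ht.1, by ring, by rw [real_smul, real_smul]; push_cast; ring⟩
  -- every parameter in `[0,1]` kills one of the four functions
  have hcover : ∀ t ∈ Icc (0:ℝ) 1, ∃ k : Fin 4, g k + t * g' k = 0 := by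
    intro t ht
    have hfr := hsub (hmemseg t ht)
    rw [mem_frontier_tiltedBox_iff c e he hα hβ] at hfr
    obtain ⟨-, hX | hY⟩ := hfr
    · rw [(hγ t).1] at hX
      rcases le_or_gt 0 (X0 + t * X1) with h0 | h0
      · exact ⟨0, by rw [abs_of_nonneg h0] at hX; simp only [hg, hg', Matrix.cons_val]; linarith⟩
      · exact ⟨1, by rw [abs_of_neg h0] at hX; simp only [hg, hg', Matrix.cons_val]; linarith⟩
    · rw [(hγ t).2] at hY
      rcases le_or_gt 0 (Y0 + t * Y1) with h0 | h0
      · refine ⟨2, ?_⟩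
        rw [abs_of_nonneg h0] at hY
        simp only [hg, hg']
        simp only [Matrix.cons_val]
        linarith
      · refine ⟨3, ?_⟩
        rw [abs_of_neg h0] at hY
        simp only [hg, hg']
        simp only [Matrix.cons_val]
        linarith
  -- five parameters pigeonhole into four side lines
  choose! kf hkf using hcover
  set T : Fin 5 → ℝ := fun j => (j : ℝ) / 4 with hTdef
  have hT : ∀ j : Fin 5, T j ∈ Icc (0:ℝ) 1 := fun j => by
    have hj : (j : ℝ) ≤ 4 := by exact_mod_cast Nat.lt_succ_iff.1 j.2
    exact ⟨by positivity, by simp only [hTdef]; rw [div_le_one (by norm_num)]; exact hj⟩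
  obtain ⟨j₁, j₂, hj, hkj⟩ : ∃ j₁ j₂ : Fin 5, j₁ ≠ j₂ ∧ kf (T j₁) = kf (T j₂) :=
    Fintype.exists_ne_map_eq_of_card_lt (fun j => kf (T j)) (by simp)
  have hTne : T j₁ ≠ T j₂ := by
    intro hEq
    apply hj
    simp only [hTdef] at hEq
    have : (j₁ : ℝ) = j₂ := by linarith [hEq]
    exact Fin.ext (by exact_mod_cast this)
  obtain ⟨k, hz₁, hz₂⟩ : ∃ k : Fin 4, g k + T j₁ * g' k = 0 ∧ g k + T j₂ * g' k = 0 :=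
    ⟨kf (T j₁), hkf _ (hT j₁), by rw [hkj]; exact hkf _ (hT j₂)⟩
  -- the affine function vanishes identically; read off the side line
  have hall : ∀ t, g k + t * g' k = 0 := affine_eq_zero_of_two_zeros hTne hz₁ hz₂
  -- every point of the segment has a parameter
  have hparam : ∀ z ∈ segment ℝ p q, ∃ t : ℝ, z = p + (t : ℂ) * (q - p) := by
    rintro z ⟨a, b, -, -, hab, rfl⟩
    refine ⟨b, ?_⟩
    rw [real_smul, real_smul]
    have : (a : ℂ) = 1 - b := by rw [← ofReal_one, ← ofReal_sub]; congr 1; linarith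
    rw [this]; ring
  obtain rfl | rfl | rfl | rfl : k = 0 ∨ k = 1 ∨ k = 2 ∨ k = 3 := by fin_cases k <;> simp
  · left
    intro z hz
    obtain ⟨t, rfl⟩ := hparam z hz
    rw [(hγ t).1]
    have := hall t
    simp only [hg, hg', Matrix.cons_val] at this
    linarith
  · right; left
    intro z hz
    obtain ⟨t, rfl⟩ := hparam z hz
    rw [(hγ t).1]
    have := hall t
    simp only [hg, hg', Matrix.cons_val] at this
    linarith
  · right; right; left
    intro z hz
    obtain ⟨t, rfl⟩ := hparam z hz
    rw [(hγ t).2]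
    have := hall t
    simp only [hg, hg', Matrix.cons_val] at this
    linarith
  · right; right; right
    intro z hz
    obtain ⟨t, rfl⟩ := hparam z hz
    rw [(hγ t).2]
    have := hall t
    simp only [hg, hg', Matrix.cons_val] at this
    linarith

end Summit.CriticalPhenomena.CardyFormulaZ2.Cruxes.ParafermionToSLESixFamilies.PotentialDarbouxPicardDiamond

end
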